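import Mathlib
import Summits.Ventures.PercRepro2.SwOutAll
import Summits.Ventures.PercRepro2.SwOutArmFlip
import Summits.Ventures.PercRepro2.SwOutArms
import Summits.Ventures.PercRepro2.SwOutArmOrbit
import Summits.Ventures.PercRepro2.SwOutArmThm
import Summits.Ventures.PercRepro2.SwOutJunctionRegion
import Summits.Ventures.PercRepro2.SwOutJunctionsSplit
import Summits.Ventures.PercRepro2.SwOutJunctionsRegion
import Summits.Ventures.PercRepro2.SwOutAdjSplit

/-!
# The internal edges are invisible to the split graph (blind cell PercRepro2, night-4 g11,
2026-08-25; proofs/NIGHT4-G11.md §5(5))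

In the graph split at `S` the internal edges of `S` are isolated loops at their own copies: two
configurations agreeing off the internal edges have the same split clusters, hull, cores, red and
blue edge sets, class and side `Q` (`cluster_splitS_congr`, …); the all-red orientation and the
orbit realisations of the split graph leave the internal edges untouched
(`allRed_splitS_apply_internal`, `orbitReal_splitS_apply_internal`).
-/

namespace Summit.Ventures.PercRepro2

namespace LocRows

open Hull

variable {V : Type*} {E : Type*} [Fintype E] [DecidableEq E]

open scoped Classical

section Congr

variable {ends : E → Sym2 V} {S : Set V}

omit [Fintype E] [DecidableEq E] in
/-- Split clusters agree for configurations agreeing off the internal edges. -/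
theorem cluster_splitS_congr {η η' : Config E} (hagree : ∀ e, ¬ Internal ends S e → η e = η' e)
    (a : V ⊕ E) : cluster (splitEndsS ends S) η a = cluster (splitEndsS ends S) η' a := by
  have key : ∀ (η η' : Config E), (∀ e, ¬ Internal ends S e → η e = η' e) →
      cluster (splitEndsS ends S) η a ⊆ cluster (splitEndsS ends S) η' a := by
    intro η η' hag v hv
    refine mem_of_conn_of_closed (ends := splitEndsS ends S) (ω := η) ?_
      (mem_cluster_self _ _ _) hv
    intro x hx y hxy
    obtain ⟨hne, e, he, hends⟩ := openGraph_adj.1 hxy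
    have hi : ¬ Internal ends S e := by
      intro hi
      rw [splitEndsS_of_internal hi, Sym2.eq_iff] at hends
      rcases hends with ⟨h1, h2⟩ | ⟨h1, h2⟩
      · exact hne (h1.symm.trans h2)
      · exact hne (h2.symm.trans h1)
    exact mem_cluster_of_edge hx (by rw [← hag e hi]; exact he) hends
  exact Set.Subset.antisymm (key η η' hagree) (key η' η fun e hi => (hagree e hi).symm)

omit [Fintype E] [DecidableEq E] in
/-- Blue split clusters agree as well. -/
theorem cluster_blue_splitS_congr {η η' : Config E}
    (hagree : ∀ e, ¬ Internal ends S e → η e = η' e) (a : V ⊕ E) :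
    cluster (splitEndsS ends S) (blue η) a = cluster (splitEndsS ends S) (blue η') a :=
  cluster_splitS_congr (fun e hi => by simp only [blue_apply, hagree e hi]) a

omit [Fintype E] [DecidableEq E] in
/-- Split hulls agree. -/
theorem hull_splitS_congr {η η' : Config E} (hagree : ∀ e, ¬ Internal ends S e → η e = η' e)
    (a : V ⊕ E) : hull (splitEndsS ends S) η a = hull (splitEndsS ends S) η' a := by
  simp only [hull, cluster_splitS_congr hagree a, cluster_blue_splitS_congr hagree a]

omit [Fintype E] [DecidableEq E] in
/-- Core-freeness transfers. -/
theorem coreFree_splitS_congr {η η' : Config E} (hagree : ∀ e, ¬ Internal ends S e → η e = η' e)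
    (a : V ⊕ E) (hc : CoreFree (splitEndsS ends S) η a) : CoreFree (splitEndsS ends S) η' a := by
  intro x hx hx'
  rw [← cluster_splitS_congr hagree a] at hx
  rw [← cluster_blue_splitS_congr hagree a] at hx'
  exact hc x hx hx'

omit [Fintype E] [DecidableEq E] in
/-- The copy of an internal edge lies in no split cluster of an `inl`-vertex. -/
lemma inr_notMem_hull_splitS_of_internal {η : Config E} {e : E} (hi : Internal ends S e) {a : V} :
    Sum.inr e ∉ hull (splitEndsS ends S) η (Sum.inl a) := by
  rintro (h1 | h1)
  · exact inr_notMem_cluster_splitS_of_internal hi h1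
  · exact inr_notMem_cluster_splitS_of_internal hi h1

omit [Fintype E] [DecidableEq E] in
/-- An internal edge is in no red edge set of the split graph at an `inl`-vertex. -/
lemma internal_notMem_redEdges_splitS {η : Config E} {e : E} (hi : Internal ends S e) {a : V} :
    e ∉ redEdges (splitEndsS ends S) η (Sum.inl a) := by
  intro he
  rw [mem_redEdges, mem_within] at he
  obtain ⟨_, x, hx, _, _, hxy⟩ := he
  rw [splitEndsS_of_internal hi, Sym2.eq_iff] at hxy
  rcases hxy with ⟨h1, _⟩ | ⟨_, h1⟩ <;> rw [← h1] at hx <;>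
    exact inr_notMem_cluster_splitS_of_internal hi hx

omit [Fintype E] [DecidableEq E] in
/-- Red edge sets of the split graph agree. -/
theorem redEdges_splitS_congr {η η' : Config E} (hagree : ∀ e, ¬ Internal ends S e → η e = η' e)
    (a : V) :
    redEdges (splitEndsS ends S) η (Sum.inl a) = redEdges (splitEndsS ends S) η' (Sum.inl a) := by
  ext e
  by_cases hi : Internal ends S e
  · exact iff_of_false (internal_notMem_redEdges_splitS hi) (internal_notMem_redEdges_splitS hi)
  · simp only [mem_redEdges, hagree e hi, cluster_splitS_congr hagree (Sum.inl a)]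

omit [Fintype E] [DecidableEq E] in
/-- Blue edge sets of the split graph agree. -/
theorem blueEdges_splitS_congr {η η' : Config E} (hagree : ∀ e, ¬ Internal ends S e → η e = η' e)
    (a : V) :
    blueEdges (splitEndsS ends S) η (Sum.inl a) = blueEdges (splitEndsS ends S) η' (Sum.inl a) :=
  redEdges_splitS_congr (fun e hi => by simp only [blue_apply, hagree e hi]) a

omit [Fintype E] [DecidableEq E] in
/-- An internal edge touches the split region. -/
lemma internal_mem_touches_splitRegionS {U : Set V} {e : E} (hi : Internal ends S e) :
    e ∈ touches (splitEndsS ends S) (splitRegionS U) :=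
  ⟨Sum.inr e, Or.inr ⟨e, rfl⟩, Sum.inr e, splitEndsS_of_internal hi⟩

/-- The class of the split graph is insensitive to the internal edges. -/
theorem mem_outClass_splitS_congr {U : Set V} {ξ η η' : Config E} {h : V}
    (hagree : ∀ e, ¬ Internal ends S e → η e = η' e)
    (hη : η ∈ outClass (splitEndsS ends S) (splitRegionS U) (Sum.inl h) ξ) :
    η' ∈ outClass (splitEndsS ends S) (splitRegionS U) (Sum.inl h) ξ := by
  rw [mem_outClass] at hη ⊢
  refine ⟨fun e he => ?_, ?_⟩
  · have hi : ¬ Internal ends S e := fun hi => he (internal_mem_touches_splitRegionS hi)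
    rw [← hagree e hi]
    exact hη.1 e he
  · rw [← hull_splitS_congr hagree]
    exact hη.2

/-- The side `Q` of the split graph is insensitive to the internal edges. -/
theorem mem_tgtU_splitS_congr {l h o : V} {η η' : Config E}
    (hagree : ∀ e, ¬ Internal ends S e → η e = η' e)
    (hη : η ∈ tgtU (splitEndsS ends S) (Sum.inl l) (Sum.inl h)
      {T : Set (V ⊕ E) | Sum.inl o ∈ T}) :
    η' ∈ tgtU (splitEndsS ends S) (Sum.inl l) (Sum.inl h) {T : Set (V ⊕ E) | Sum.inl o ∈ T} := by
  rw [mem_tgtU_iff'] at hη ⊢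
  rw [← hull_splitS_congr hagree, ← cluster_splitS_congr hagree, ← cluster_blue_splitS_congr hagree]
  exact hη

omit [Fintype E] [DecidableEq E] in
/-- An internal edge touches no subset of the split hull. -/
lemma internal_notMem_touches_of_subset_hull {η : Config E} {e : E} (hi : Internal ends S e)
    {a : V} {P : Set (V ⊕ E)} (hP : P ⊆ hull (splitEndsS ends S) η (Sum.inl a)) :
    e ∉ touches (splitEndsS ends S) P := by
  rintro ⟨x, hx, y, hxy⟩
  rw [splitEndsS_of_internal hi, Sym2.eq_iff] at hxy
  rcases hxy with ⟨h1, _⟩ | ⟨_, h1⟩ <;> rw [← h1] at hx <;>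
    exact inr_notMem_hull_splitS_of_internal hi (hP hx)

omit [Fintype E] [DecidableEq E] in
/-- The all-red orientation of the split graph leaves the internal edges untouched. -/
lemma allRed_splitS_apply_internal {η : Config E} {h : V} {e : E} (hi : Internal ends S e) :
    allRed (splitEndsS ends S) η (Sum.inl h) e = η e := by
  unfold allRed
  exact flip_apply_of_notMem (internal_notMem_touches_of_subset_hull (η := η) (a := h) hi
    (fun _ hx => Or.inr hx.1))

omit [Fintype E] [DecidableEq E] in
/-- The all-red orientations agree off the internal edges for configurations that do. -/
lemma allRed_splitS_congr {η η' : Config E} {h : V}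
    (hagree : ∀ e, ¬ Internal ends S e → η e = η' e) {e : E} (hi : ¬ Internal ends S e) :
    allRed (splitEndsS ends S) η (Sum.inl h) e = allRed (splitEndsS ends S) η' (Sum.inl h) e := by
  unfold allRed
  rw [cluster_blue_splitS_congr hagree]
  by_cases ht : e ∈ touches (splitEndsS ends S) (cluster (splitEndsS ends S) (blue η') (Sum.inl h) \ {Sum.inl h})
  · rw [flip_apply_of_mem ht, flip_apply_of_mem ht, hagree e hi]
  · rw [flip_apply_of_notMem ht, flip_apply_of_notMem ht, hagree e hi]

omit [DecidableEq E] in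
/-- An orbit realisation of the split graph leaves the internal edges untouched. -/
lemma orbitReal_splitS_apply_internal {ζ : Config E} {h : V}
    (ω : Config (arms (splitEndsS ends S) ζ (Sum.inl h))) {e : E} (hi : Internal ends S e) :
    orbitReal (splitEndsS ends S) ζ (Sum.inl h) ω e = ζ e := by
  unfold orbitReal
  rw [flip_apply_of_notMem (internal_notMem_touches_of_subset_hull (η := ζ) (a := h) hi
    (fun _ hx => (mem_hull_sdiff_of_mem_armsFalse hx).1))]
  exact allRed_splitS_apply_internal hi

end Congr

end LocRows

end Summit.Ventures.PercRepro2
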